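import Literature.Analysis.FluidPDE.DivCurlLpEstimate
import Literature.Analysis.FluidPDE.TaoEnstrophyLocalisationProofs
import Summits.NavierStokesRegularity.NavierStokesRegularity.Theorems.ExtremiserTransienceTwoThirdsGauge
import HarnessLib

/-!
# Route `ExtremiserTransience`, crux `NearExtremalTransiencePerFlow` (stmt-NavierStokesRegularity-26567), LINE g10-1 «two_thirds»
# (ns-idea-10 g10), stub S2 `FirstOrderIdentity`: `L²` BOUNDS FOR THE DERIVATIVES OF THE BIOT–SAVART GAUGE

Helper file for S2 (`--supports stmt-NavierStokesRegularity-26567`).  The layer junk of S2 pairs the enstrophy of the light layer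
against `L²` norms of the first and second derivatives of the gauge `ψ = K ∗ h` (`h = ζV` a truncation of the limit field); this
file turns the tree's Calderón–Zygmund inequalities (stated with `eLpNorm`) into the plain `∫ ‖·‖²` bounds used there:

* `toReal_eLpNorm_sq_eq_integral`, `integral_norm_sq_le_of_eLpNorm_le` — plumbing `‖f‖²_{L²} = ∫‖f‖²`;
* `exists_integral_norm_sq_fderiv_biotSavart_le` — `∫ ‖D(K ∗ h)‖² ≤ C ∫ ‖h‖²` for test fields `h`
  (the tree's `exists_eLpNorm_fderiv_biotSavart_le` at `p = 2`);
* `fderiv_biotSavart_apply_eq_biotSavart_fderiv` — derivatives fall on the source: `∂ᵥ(K ∗ h) = K ∗ (∂ᵥ h)`;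
* `opNorm_le_sum_norm_apply_basisFun`, `norm_iteratedFDeriv_two_le_sum` — `‖T‖ ≤ Σₗ ‖T eₗ‖`, `‖D²ψ(x)‖ ≤ Σₗ ‖D(∂ₗψ)(x)‖`;
* `exists_integral_norm_sq_iteratedFDeriv_two_biotSavart_le` — `∫ ‖D²(K ∗ h)‖² ≤ C ∫ ‖Dh‖²`;
* `exists_integral_norm_sq_fderiv_le_curl_add_div` — the `L²` div–curl estimate `∫‖Du‖² ≤ C(∫‖curl u‖² + ∫(div u)²)` for test
  fields (the tree's `exists_eLpNorm_fderiv_le_curl_add_divergence` at `p = 2`).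

HONEST FRAMING: potential theory on `ℝ³`; nothing about Navier–Stokes regularity or blow-up is proved; S2, the crux ⟨26567⟩ and NS
regularity are OPEN; no summit is proved by a line. [folklore]
-/

noncomputable section

open MeasureTheory Set Filter Topology Metric
open scoped ENNReal NNReal RealInnerProductSpace ContDiff Convolution
open Literature.Analysis.FluidPDE ContinuousLinearMap

namespace Summit.NavierStokesRegularity.NavierStokesRegularity.Theorems.NearExtremalTransiencePerFlow.TwoThirds

-- the summit's namespace repeats the problem name by convention (D-0017)
set_option linter.dupNamespace false

/-! ## Plumbing: `L²` norms as integrals -/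

/-- `‖u‖_{L²}² = ∫ ‖u‖²` for `u ∈ L²` (real numbers). [folklore] -/
theorem toReal_eLpNorm_sq_eq_integral {H : Type*} [NormedAddCommGroup H] {u : EuclideanSpace ℝ (Fin 3) → H}
    (hu : MemLp u 2 volume) : (eLpNorm u 2 volume).toReal ^ 2 = ∫ x, ‖u x‖ ^ 2 := by
  have h0 : 0 ≤ ∫ x, ‖u x‖ ^ (2 : ℝ) := integral_nonneg fun x => by positivity
  rw [hu.eLpNorm_eq_integral_rpow_norm two_ne_zero ENNReal.ofNat_ne_top, ENNReal.toReal_ofNat,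
    ENNReal.toReal_ofReal (by positivity), show (2 : ℝ)⁻¹ = ((2 : ℕ) : ℝ)⁻¹ by norm_num,
    Real.rpow_inv_natCast_pow h0 two_ne_zero]
  exact integral_congr_ae (Eventually.of_forall fun x => Real.rpow_two _)

/-- From `‖f‖_{L²} ≤ C‖g‖_{L²}` (`g ∈ L²`, `f` measurable) to `∫‖f‖² ≤ C² ∫‖g‖²` (and `‖f‖² ∈ L¹`). [folklore] -/
theorem integral_norm_sq_le_of_eLpNorm_le {F G : Type*} [NormedAddCommGroup F] [NormedAddCommGroup G]
    {f : EuclideanSpace ℝ (Fin 3) → F} {g : EuclideanSpace ℝ (Fin 3) → G} (hf : AEStronglyMeasurable f volume)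
    (hg : MemLp g 2 volume) {C : ℝ≥0} (hle : eLpNorm f 2 volume ≤ C * eLpNorm g 2 volume) :
    Integrable (fun x => ‖f x‖ ^ 2) ∧ ∫ x, ‖f x‖ ^ 2 ≤ (C : ℝ) ^ 2 * ∫ x, ‖g x‖ ^ 2 := by
  have hgfin : eLpNorm g 2 volume < ⊤ := hg.eLpNorm_lt_top
  have hffin : eLpNorm f 2 volume < ⊤ := hle.trans_lt (ENNReal.mul_lt_top ENNReal.coe_lt_top hgfin)
  have hfm : MemLp f 2 volume := ⟨hf, hffin⟩
  have hfi : Integrable (fun x => ‖f x‖ ^ 2) := by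
    have h := hfm.integrable_norm_rpow two_ne_zero ENNReal.ofNat_ne_top
    rw [ENNReal.toReal_ofNat] at h
    exact h.congr (Eventually.of_forall fun x => Real.rpow_two _)
  refine ⟨hfi, ?_⟩
  have h1 : (eLpNorm f 2 volume).toReal ≤ (C : ℝ) * (eLpNorm g 2 volume).toReal := by
    have h := ENNReal.toReal_mono (ENNReal.mul_ne_top ENNReal.coe_ne_top hgfin.ne) hle
    rwa [ENNReal.toReal_mul, ENNReal.coe_toReal] at h
  rw [← toReal_eLpNorm_sq_eq_integral hfm, ← toReal_eLpNorm_sq_eq_integral hg]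
  have h2 : 0 ≤ (eLpNorm f 2 volume).toReal := ENNReal.toReal_nonneg
  calc (eLpNorm f 2 volume).toReal ^ 2 ≤ ((C : ℝ) * (eLpNorm g 2 volume).toReal) ^ 2 := pow_le_pow_left₀ h2 h1 2
    _ = (C : ℝ) ^ 2 * (eLpNorm g 2 volume).toReal ^ 2 := by ring

/-! ## First derivatives of the gauge -/

variable {h : EuclideanSpace ℝ (Fin 3) → EuclideanSpace ℝ (Fin 3)}

/-- **`∫ ‖D(K ∗ h)‖² ≤ C ∫ ‖h‖²`** for smooth compactly supported `h` (Calderón–Zygmund at `p = 2`, the tree's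
`exists_eLpNorm_fderiv_biotSavart_le`). [folklore] -/
theorem exists_integral_norm_sq_fderiv_biotSavart_le :
    ∃ C : ℝ, 0 ≤ C ∧ ∀ h : EuclideanSpace ℝ (Fin 3) → EuclideanSpace ℝ (Fin 3), ContDiff ℝ (⊤ : ℕ∞) h →
      HasCompactSupport h →
        Integrable (fun x => ‖fderiv ℝ (biotSavart h) x‖ ^ 2) ∧
          ∫ x, ‖fderiv ℝ (biotSavart h) x‖ ^ 2 ≤ C * ∫ x, ‖h x‖ ^ 2 := by
  obtain ⟨C, hC⟩ := exists_eLpNorm_fderiv_biotSavart_le (p := 2) (by norm_num) ENNReal.ofNat_lt_top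
  refine ⟨(C : ℝ) ^ 2, by positivity, fun h hh hc => ?_⟩
  have hψ : ContDiff ℝ (⊤ : ℕ∞) (biotSavart h) := (contDiff_biotSavart_test hh hc).1
  have hm : AEStronglyMeasurable (fderiv ℝ (biotSavart h)) volume :=
    (hψ.continuous_fderiv (by simp)).aestronglyMeasurable
  exact integral_norm_sq_le_of_eLpNorm_le hm (hh.continuous.memLp_of_hasCompactSupport hc) (hC h hh hc)

/-- A directional derivative of a test field is a test field (smoothness). [folklore] -/
theorem contDiff_fderiv_apply_of_test (hh : ContDiff ℝ (⊤ : ℕ∞) h) (v : EuclideanSpace ℝ (Fin 3)) :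
    ContDiff ℝ (⊤ : ℕ∞) fun y => fderiv ℝ h y v :=
  (hh.fderiv_right (m := (⊤ : ℕ∞)) le_rfl).clm_apply contDiff_const

/-- A directional derivative of a test field is a test field (support). [folklore] -/
theorem hasCompactSupport_fderiv_apply_of_test (hc : HasCompactSupport h) (v : EuclideanSpace ℝ (Fin 3)) :
    HasCompactSupport fun y => fderiv ℝ h y v :=
  hc.fderiv_apply (𝕜 := ℝ) v

/-- **Derivatives fall on the source**: `∂ᵥ (K ∗ h)(x) = (K ∗ ∂ᵥh)(x)` for smooth compactly supported `h` (componentwise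
`(K ∗ h)ᵢ = −Γ ∗ (curl h)ᵢ`, `∂ᵥ(Γ ∗ s) = Γ ∗ ∂ᵥ s`, and `∂ᵥ curl h = curl ∂ᵥ h`). [folklore] -/
theorem fderiv_biotSavart_apply_eq_biotSavart_fderiv (hh : ContDiff ℝ (⊤ : ℕ∞) h) (hc : HasCompactSupport h)
    (x v : EuclideanSpace ℝ (Fin 3)) :
    fderiv ℝ (biotSavart h) x v = biotSavart (fun y => fderiv ℝ h y v) x := by
  have hψ : ContDiff ℝ (⊤ : ℕ∞) (biotSavart h) := (contDiff_biotSavart_test hh hc).1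
  have hψd : DifferentiableAt ℝ (biotSavart h) x := (hψ.differentiable (by simp)) x
  have hh2 : ContDiff ℝ 2 h := hh.of_le (by norm_cast)
  have hhv : ContDiff ℝ (⊤ : ℕ∞) fun y => fderiv ℝ h y v := contDiff_fderiv_apply_of_test hh v
  have hhvc : HasCompactSupport fun y => fderiv ℝ h y v := hasCompactSupport_fderiv_apply_of_test hc v
  ext i
  -- the `i`-th component of the left side
  rw [← fderiv_apply_comp hψd i v]
  have e : (fun y => biotSavart h y i) = fun y => -((fun x => curl h x i) ⋆[lsmul ℝ ℝ, volume] newtonKernel) y :=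
    funext fun y => biotSavart_apply_eq_neg_convolution_curl_apply hh hc y i
  have hci : ContDiff ℝ 1 fun x => curl h x i :=
    (contDiff_curl_apply_of_test hh i).of_le (by norm_cast)
  have hcic : HasCompactSupport fun x => curl h x i :=
    (hasCompactSupport_curl hc).comp_left (g := fun w : EuclideanSpace ℝ (Fin 3) => w i) rfl
  rw [e, fderiv_fun_neg, neg_apply, fderiv_convolution_newtonKernel_apply hci hcic x v,
    biotSavart_apply_eq_neg_convolution_curl_apply hhv hhvc x i]
  congr 2
  funext t
  -- `∂ᵥ (curl h)ᵢ = (curl ∂ᵥ h)ᵢ`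
  have hcd : DifferentiableAt ℝ (curl h) t := ((contDiff_curl (n := 1) hh2).differentiable one_ne_zero) t
  rw [fderiv_apply_comp hcd i v, curl_fderiv_apply hh2 t v]

/-! ## Second derivatives of the gauge -/

/-- `‖T‖ ≤ Σₗ ‖T eₗ‖` for a continuous linear map out of `ℝ³` (expansion in the standard basis). [folklore] -/
theorem opNorm_le_sum_norm_apply_basisFun {F : Type*} [NormedAddCommGroup F] [NormedSpace ℝ F]
    (T : EuclideanSpace ℝ (Fin 3) →L[ℝ] F) : ‖T‖ ≤ ∑ l, ‖T (EuclideanSpace.basisFun (Fin 3) ℝ l)‖ := by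
  refine ContinuousLinearMap.opNorm_le_bound _ (Finset.sum_nonneg fun l _ => norm_nonneg _) fun u => ?_
  have hu : T u = ∑ l, u l • T (EuclideanSpace.basisFun (Fin 3) ℝ l) := by
    have hrepr : u = ∑ l, u l • EuclideanSpace.basisFun (Fin 3) ℝ l := by
      simpa using ((EuclideanSpace.basisFun (Fin 3) ℝ).sum_repr u).symm
    conv_lhs => rw [hrepr]
    simp [map_sum, map_smul]
  rw [hu, Finset.sum_mul]
  refine (norm_sum_le _ _).trans (Finset.sum_le_sum fun l _ => ?_)
  rw [norm_smul, mul_comm]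
  exact mul_le_mul_of_nonneg_left ((Real.norm_eq_abs _).symm ▸ (PiLp.norm_apply_le u l)) (norm_nonneg _)

/-- **`‖D²ψ(x)‖ ≤ Σₗ ‖D(∂ₗψ)(x)‖`** for a `C²` map `ψ` (no symmetry of second derivatives is used:
`(D²ψ(x) w) eₗ = D(∂ₗψ)(x) w`). [folklore] -/
theorem norm_iteratedFDeriv_two_le_sum {F : Type*} [NormedAddCommGroup F] [NormedSpace ℝ F]
    {ψ : EuclideanSpace ℝ (Fin 3) → F} (hψ : ContDiff ℝ 2 ψ) (x : EuclideanSpace ℝ (Fin 3)) :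
    ‖iteratedFDeriv ℝ 2 ψ x‖ ≤ ∑ l, ‖fderiv ℝ (fun y => fderiv ℝ ψ y (EuclideanSpace.basisFun (Fin 3) ℝ l)) x‖ := by
  rw [← norm_iteratedFDeriv_fderiv, norm_iteratedFDeriv_one]
  have hD : DifferentiableAt ℝ (fderiv ℝ ψ) x :=
    ((hψ.fderiv_right (m := 1) (by norm_num)).differentiable one_ne_zero) x
  have hcomp : ∀ (l : Fin 3) (w : EuclideanSpace ℝ (Fin 3)),
      fderiv ℝ (fderiv ℝ ψ) x w (EuclideanSpace.basisFun (Fin 3) ℝ l) =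
        fderiv ℝ (fun y => fderiv ℝ ψ y (EuclideanSpace.basisFun (Fin 3) ℝ l)) x w := by
    intro l w
    rw [fderiv_clm_apply hD (differentiableAt_const _)]
    simp
  refine ContinuousLinearMap.opNorm_le_bound _ (Finset.sum_nonneg fun l _ => norm_nonneg _) fun w => ?_
  calc ‖fderiv ℝ (fderiv ℝ ψ) x w‖ ≤ ∑ l, ‖fderiv ℝ (fderiv ℝ ψ) x w (EuclideanSpace.basisFun (Fin 3) ℝ l)‖ :=
        opNorm_le_sum_norm_apply_basisFun _
    _ = ∑ l, ‖fderiv ℝ (fun y => fderiv ℝ ψ y (EuclideanSpace.basisFun (Fin 3) ℝ l)) x w‖ := by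
        simp_rw [hcomp]
    _ ≤ ∑ l, ‖fderiv ℝ (fun y => fderiv ℝ ψ y (EuclideanSpace.basisFun (Fin 3) ℝ l)) x‖ * ‖w‖ :=
        Finset.sum_le_sum fun l _ => ContinuousLinearMap.le_opNorm _ _
    _ = (∑ l, ‖fderiv ℝ (fun y => fderiv ℝ ψ y (EuclideanSpace.basisFun (Fin 3) ℝ l)) x‖) * ‖w‖ := by
        rw [Finset.sum_mul]

/-- **`∫ ‖D²(K ∗ h)‖² ≤ C ∫ ‖Dh‖²`** for smooth compactly supported `h`: `∂ₗ(K ∗ h) = K ∗ ∂ₗh` and Calderón–Zygmund at `p = 2`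
for each of the three test fields `∂ₗ h`. [folklore] -/
theorem exists_integral_norm_sq_iteratedFDeriv_two_biotSavart_le :
    ∃ C : ℝ, 0 ≤ C ∧ ∀ h : EuclideanSpace ℝ (Fin 3) → EuclideanSpace ℝ (Fin 3), ContDiff ℝ (⊤ : ℕ∞) h →
      HasCompactSupport h →
        Integrable (fun x => ‖iteratedFDeriv ℝ 2 (biotSavart h) x‖ ^ 2) ∧
          ∫ x, ‖iteratedFDeriv ℝ 2 (biotSavart h) x‖ ^ 2 ≤ C * ∫ x, ‖fderiv ℝ h x‖ ^ 2 := by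
  obtain ⟨C, hC0, hC⟩ := exists_integral_norm_sq_fderiv_biotSavart_le
  refine ⟨9 * C, by positivity, fun h hh hc => ?_⟩
  set e := EuclideanSpace.basisFun (Fin 3) ℝ with he
  have hψ : ContDiff ℝ (⊤ : ℕ∞) (biotSavart h) := (contDiff_biotSavart_test hh hc).1
  have hψ2 : ContDiff ℝ 2 (biotSavart h) := hψ.of_le (by norm_cast)
  -- the three derivative test fields and their potentials
  have hhl : ∀ l, ContDiff ℝ (⊤ : ℕ∞) fun y => fderiv ℝ h y (e l) := fun l => contDiff_fderiv_apply_of_test hh (e l)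
  have hhlc : ∀ l, HasCompactSupport fun y => fderiv ℝ h y (e l) := fun l => hasCompactSupport_fderiv_apply_of_test hc (e l)
  have hψl : ∀ l, (fun y => fderiv ℝ (biotSavart h) y (e l)) = biotSavart (fun y => fderiv ℝ h y (e l)) := fun l =>
    funext fun y => fderiv_biotSavart_apply_eq_biotSavart_fderiv hh hc y (e l)
  have hl : ∀ l, Integrable (fun x => ‖fderiv ℝ (fun y => fderiv ℝ (biotSavart h) y (e l)) x‖ ^ 2) ∧
      ∫ x, ‖fderiv ℝ (fun y => fderiv ℝ (biotSavart h) y (e l)) x‖ ^ 2 ≤ C * ∫ x, ‖fderiv ℝ h x (e l)‖ ^ 2 := by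
    intro l
    rw [hψl l]
    exact hC _ (hhl l) (hhlc l)
  -- `∫ ‖∂ₗ h‖² ≤ ∫ ‖Dh‖²`
  have hDhc : Continuous fun x => ‖fderiv ℝ h x‖ ^ 2 := ((hh.continuous_fderiv (by simp)).norm).pow 2
  have hDhs : HasCompactSupport fun x => ‖fderiv ℝ h x‖ ^ 2 := by
    refine (hc.fderiv (𝕜 := ℝ)).mono fun x hx => ?_
    rw [Function.mem_support] at hx ⊢
    intro h0
    exact hx (by rw [h0, norm_zero, zero_pow two_ne_zero])
  have hDhi : Integrable fun x => ‖fderiv ℝ h x‖ ^ 2 := hDhc.integrable_of_hasCompactSupport hDhs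
  have hel : ∀ l, ‖e l‖ = 1 := fun l => by simp [he, EuclideanSpace.basisFun_apply]
  have hle : ∀ l, ∫ x, ‖fderiv ℝ h x (e l)‖ ^ 2 ≤ ∫ x, ‖fderiv ℝ h x‖ ^ 2 := by
    intro l
    refine integral_mono_of_nonneg (Eventually.of_forall fun x => by positivity) hDhi
      (Eventually.of_forall fun x => ?_)
    have h1 : ‖fderiv ℝ h x (e l)‖ ≤ ‖fderiv ℝ h x‖ := by
      calc ‖fderiv ℝ h x (e l)‖ ≤ ‖fderiv ℝ h x‖ * ‖e l‖ := ContinuousLinearMap.le_opNorm _ _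
        _ = ‖fderiv ℝ h x‖ := by rw [hel l, mul_one]
    exact pow_le_pow_left₀ (norm_nonneg _) h1 2
  -- pointwise: `‖D²ψ‖² ≤ 3 Σₗ ‖D ∂ₗψ‖²`
  set g : Fin 3 → EuclideanSpace ℝ (Fin 3) → ℝ := fun l x =>
    ‖fderiv ℝ (fun y => fderiv ℝ (biotSavart h) y (e l)) x‖ ^ 2 with hg
  have hpt : ∀ x, ‖iteratedFDeriv ℝ 2 (biotSavart h) x‖ ^ 2 ≤ 3 * ∑ l, g l x := by
    intro x
    have h1 := norm_iteratedFDeriv_two_le_sum hψ2 x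
    have h2 := pow_le_pow_left₀ (norm_nonneg _) h1 2
    refine h2.trans ?_
    have h3 := sq_sum_le_card_mul_sum_sq (s := (Finset.univ : Finset (Fin 3)))
      (f := fun l => ‖fderiv ℝ (fun y => fderiv ℝ (biotSavart h) y (e l)) x‖)
    simp only [Finset.card_univ, Fintype.card_fin, Nat.cast_ofNat] at h3
    exact h3
  have hsum : Integrable fun x => 3 * ∑ l, g l x :=
    (integrable_finsetSum _ fun l _ => (hl l).1).const_mul 3
  have hmeas : AEStronglyMeasurable (fun x => ‖iteratedFDeriv ℝ 2 (biotSavart h) x‖ ^ 2) volume :=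
    ((hψ2.continuous_iteratedFDeriv (m := 2) le_rfl).norm.pow 2).aestronglyMeasurable
  have hint : Integrable fun x => ‖iteratedFDeriv ℝ 2 (biotSavart h) x‖ ^ 2 := by
    refine hsum.mono' hmeas (Eventually.of_forall fun x => ?_)
    rw [Real.norm_eq_abs, abs_of_nonneg (by positivity)]
    exact hpt x
  refine ⟨hint, ?_⟩
  calc ∫ x, ‖iteratedFDeriv ℝ 2 (biotSavart h) x‖ ^ 2 ≤ ∫ x, 3 * ∑ l, g l x :=
        integral_mono hint hsum hpt
    _ = 3 * ∑ l, ∫ x, g l x := by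
        rw [integral_const_mul, integral_finsetSum _ fun l _ => (hl l).1]
    _ ≤ 3 * ∑ _l : Fin 3, C * ∫ x, ‖fderiv ℝ h x‖ ^ 2 := by
        gcongr with l
        exact (hl l).2.trans (mul_le_mul_of_nonneg_left (hle l) hC0)
    _ = 9 * C * ∫ x, ‖fderiv ℝ h x‖ ^ 2 := by
        rw [Finset.sum_const, Finset.card_univ, Fintype.card_fin, nsmul_eq_mul]
        push_cast
        ring

/-! ## The `L²` div–curl estimate for test fields -/

/-- **`∫ ‖Du‖² ≤ C (∫ ‖curl u‖² + ∫ (div u)²)`** for smooth compactly supported `u : ℝ³ → ℝ³` (the tree's `L^p` div–curl estimate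
`exists_eLpNorm_fderiv_le_curl_add_divergence` at `p = 2`). [folklore] -/
theorem exists_integral_norm_sq_fderiv_le_curl_add_div :
    ∃ C : ℝ, 0 ≤ C ∧ ∀ u : EuclideanSpace ℝ (Fin 3) → EuclideanSpace ℝ (Fin 3), ContDiff ℝ (⊤ : ℕ∞) u →
      HasCompactSupport u →
        ∫ x, ‖fderiv ℝ u x‖ ^ 2 ≤ C * ((∫ x, ‖curl u x‖ ^ 2) + ∫ x, (VectorCalculus.divergence u x) ^ 2) := by
  obtain ⟨C, hC⟩ := exists_eLpNorm_fderiv_le_curl_add_divergence (p := 2) (by norm_num) ENNReal.ofNat_lt_top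
  refine ⟨2 * (C : ℝ) ^ 2, by positivity, fun u hu huc => ?_⟩
  have hu1 : ContDiff ℝ 1 u := hu.of_le (by norm_cast)
  -- the three `L²` functions
  have hDm : MemLp (fderiv ℝ u) 2 volume :=
    (hu.continuous_fderiv (by simp)).memLp_of_hasCompactSupport (huc.fderiv (𝕜 := ℝ))
  have hcm : MemLp (curl u) 2 volume :=
    (continuous_curl hu1).memLp_of_hasCompactSupport (hasCompactSupport_curl huc)
  have hdm : MemLp (VectorCalculus.divergence u) 2 volume :=
    (continuous_divergence_of_test hu1).memLp_of_hasCompactSupport (hasCompactSupport_divergence huc)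
  -- real numbers
  set a : ℝ := (eLpNorm (fderiv ℝ u) 2 volume).toReal with ha
  set b : ℝ := (eLpNorm (curl u) 2 volume).toReal with hb
  set d : ℝ := (eLpNorm (VectorCalculus.divergence u) 2 volume).toReal with hd
  have hb0 : 0 ≤ b := ENNReal.toReal_nonneg
  have hd0 : 0 ≤ d := ENNReal.toReal_nonneg
  have habd : a ≤ (C : ℝ) * (b + d) := by
    have hne : (C : ℝ≥0∞) * (eLpNorm (curl u) 2 volume + eLpNorm (VectorCalculus.divergence u) 2 volume) ≠ ⊤ :=
      ENNReal.mul_ne_top ENNReal.coe_ne_top (ENNReal.add_ne_top.2 ⟨hcm.eLpNorm_ne_top, hdm.eLpNorm_ne_top⟩)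
    have h := ENNReal.toReal_mono hne (hC u hu huc)
    rwa [ENNReal.toReal_mul, ENNReal.coe_toReal, ENNReal.toReal_add hcm.eLpNorm_ne_top hdm.eLpNorm_ne_top] at h
  have ha2 : a ^ 2 = ∫ x, ‖fderiv ℝ u x‖ ^ 2 := toReal_eLpNorm_sq_eq_integral hDm
  have hb2 : b ^ 2 = ∫ x, ‖curl u x‖ ^ 2 := toReal_eLpNorm_sq_eq_integral hcm
  have hd2 : d ^ 2 = ∫ x, (VectorCalculus.divergence u x) ^ 2 := by
    rw [hd, toReal_eLpNorm_sq_eq_integral hdm]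
    exact integral_congr_ae (Eventually.of_forall fun x => by simp [Real.norm_eq_abs, sq_abs])
  rw [← ha2, ← hb2, ← hd2]
  have ha0 : 0 ≤ a := ENNReal.toReal_nonneg
  calc a ^ 2 ≤ ((C : ℝ) * (b + d)) ^ 2 := pow_le_pow_left₀ ha0 habd 2
    _ ≤ 2 * (C : ℝ) ^ 2 * (b ^ 2 + d ^ 2) := by nlinarith [sq_nonneg (b - d), sq_nonneg (C : ℝ)]

end Summit.NavierStokesRegularity.NavierStokesRegularity.Theorems.NearExtremalTransiencePerFlow.TwoThirds

end
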